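import Summits.HodgeConjecture.HodgeConjecture.Theorems.HeckePrymWeilWeilTwelvefoldsSqrtMinus7OfDeligneWeilFamily
import Summits.HodgeConjecture.HodgeConjecture.Theorems.HeckePrymWeilFamilySectorGlue
import Summits.HodgeConjecture.HodgeConjecture.Theorems.HeckePrymWeilWeilTwelvefoldsSqrtMinus7TensorLocus
import HarnessLib

/-!
# `WeilTwelvefoldsSqrtMinus7` from the two ROUTE DECLS `DeligneWeilFamily` and `WeilVariationalHodge` — BY NAME

Route `HeckePrymWeil` (sub-problem `HodgeConjecture`); crux `WeilTwelvefoldsSqrtMinus7`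
(item stmt-HodgeConjecture-1261), line `isotypic-unimodular-saturation`, skeleton r7 (lead seat c10, 2026-08-16).

Since route rev 19/20 the route file `Theses/HeckePrymWeil.lean` RENDERS the promoted item
stmt-HodgeConjecture-16866 as the decl `HeckePrymWeil.DeligneWeilFamily` and the support item
stmt-HodgeConjecture-17036 as `HeckePrymWeil.FamilySectorGlue` (proved: `Theorems.familySectorGlue_proof`).
The closure of this crux from the two route items was necessarily landed against the ITEM STATEMENT of 16866
written out verbatim (`HeckePrymWeilLine.weilTwelvefoldsSqrtMinus7_of_weilVariationalHodge_of_deligneWeilFamily`,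
p127521, the decl did not yet exist).  This file restates it in the route's own vocabulary:

* `weilTwelvefoldsSqrtMinus7_of_deligneWeilFamilyDecl_of_weilVariationalHodge :
    DeligneWeilFamily → WeilVariationalHodge → WeilTwelvefoldsSqrtMinus7` — the crux (rung `(p, g') = (7, 3)`,
  i.e. `HWA(7, 6)`) is, BY NAME, a corollary of the two route decls `DeligneWeilFamily` (stmt-16866: Deligne's
  abelian scheme with `𝒪_K`-action through the balanced `(A, φ)`, with its tensor fibre) and
  `WeilVariationalHodge` (stmt-14497: variational Hodge along `√-p`-Weil families) — the machine-readable form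
  of the line's terminal state "crux ⟸ 16866 ∧ 14497" (skeleton r7: stub 1 = `DeligneWeilFamily` by name,
  stub 2 = the Weil transport `WT(7,6)` ⟸ `WeilVariationalHodge`);
* `weilTwelvefoldsSqrtMinus7_of_familySectorGlue` — the same through the rendered support decl
  `FamilySectorGlue` at `(p, n) = (7, 6)`: the crux is literally the `(7, 6)` instance of the sector glue
  (the numerals `2 * 6 = 12`, `((7 : ℕ) : ℤ) = 7`, `Real.sqrt ((7 : ℕ) : ℝ) = Real.sqrt 7` are the only
  rewriting), and `weilTwelvefoldsSqrtMinus7_of_routeItems` discharges its first hypothesis by the landed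
  `familySectorGlue_proof`;
* `weilTwelvefoldsSqrtMinus7_iff_offTensorLocus` — what EXACTLY remains unconditionally: by the landed
  tensor-locus theorem (`weilTwelvefoldsSqrtMinus7_on_tensorLocus`, Deligne's Lemma 4.5 anchor across an
  isogeny pair, no hypothesis) the crux is EQUIVALENT to its restriction to the `(A, φ)` admitting NO isogeny
  pair towards a tensor point `(A₁ × A₁, (x, y) ↦ (-7·y, x))` — the honest residual statement that the Weil
  transport `WT(7,6)` is asked to deliver.

Pure composition of landed theorems by `δ`-unfolding of the route decls; no `sorry`, no definition, standard axioms.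
-/

noncomputable section

-- every declaration of this problem lives in `Summit.HodgeConjecture.HodgeConjecture.…` (summit = sub-problem)
set_option linter.dupNamespace false

open CategoryTheory

namespace Summit.HodgeConjecture.HodgeConjecture.Theorems.HeckePrymWeilLine

open Literature.AlgebraicGeometry Literature.AlgebraicGeometry.Motives Literature.AlgebraicGeometry.HodgeTheory
open Summit.HodgeConjecture.HodgeConjecture.Theses.HeckePrymWeil

/-- **The crux `WeilTwelvefoldsSqrtMinus7` (stmt-HodgeConjecture-1261) is a corollary of the two route decls
`DeligneWeilFamily` (stmt-HodgeConjecture-16866) and `WeilVariationalHodge` (stmt-HodgeConjecture-14497)**, by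
name: unfold `DeligneWeilFamily` (its body is the item's statement verbatim) and apply the landed closure
`weilTwelvefoldsSqrtMinus7_of_weilVariationalHodge_of_deligneWeilFamily` (item ⟹ `deligne1982_weilFamily_kAction`
⟹ `…_globalAction` ⟹ Weil transport at `M = 6` from the tensor fibre ⟹ `HWA(7, 6)`).
[cite: Deligne1982HodgeCycles, proof of Thm. 4.8 (pp. 47–52) with Prop. 4.4 and Lemma 4.5]
[cite: Grothendieck1966, footnote 13] -/
theorem weilTwelvefoldsSqrtMinus7_of_deligneWeilFamilyDecl_of_weilVariationalHodge :
    Summit.HodgeConjecture.HodgeConjecture.Theses.HeckePrymWeil.DeligneWeilFamily →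
      Summit.HodgeConjecture.HodgeConjecture.Theses.HeckePrymWeil.WeilVariationalHodge →
        Summit.HodgeConjecture.HodgeConjecture.Theses.HeckePrymWeil.WeilTwelvefoldsSqrtMinus7 :=
  fun hF hV => weilTwelvefoldsSqrtMinus7_of_weilVariationalHodge_of_deligneWeilFamily hF hV

/-- **The crux is the `(p, n) = (7, 6)` instance of the rendered support decl `FamilySectorGlue`**
(stmt-HodgeConjecture-17036): `FamilySectorGlue → DeligneWeilFamily → WeilVariationalHodge →
WeilTwelvefoldsSqrtMinus7`, instantiating the sector statement at the prime `7` (`7 % 4 = 3`, `7 ≤ 7`) and the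
half-dimension `6` (`A.dim = 2 * 6` is `A.dim = 12`, `((7 : ℕ) : ℤ) = 7`, `√((7 : ℕ) : ℝ) = √7`).
[cite: Deligne1982HodgeCycles, proof of Thm. 4.8] [cite: Grothendieck1966, footnote 13] -/
theorem weilTwelvefoldsSqrtMinus7_of_familySectorGlue :
    Summit.HodgeConjecture.HodgeConjecture.Theses.HeckePrymWeil.FamilySectorGlue →
      Summit.HodgeConjecture.HodgeConjecture.Theses.HeckePrymWeil.DeligneWeilFamily →
        Summit.HodgeConjecture.HodgeConjecture.Theses.HeckePrymWeil.WeilVariationalHodge →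
          Summit.HodgeConjecture.HodgeConjecture.Theses.HeckePrymWeil.WeilTwelvefoldsSqrtMinus7 := by
  intro hG hF hV A φ hA hφ c hrat hH hW
  have h := hG hF hV 7 (by norm_num) (by norm_num) le_rfl 6 (by norm_num) A φ hA (by exact_mod_cast hφ) c hrat hH
  exact h (by exact_mod_cast hW)

/-- **The crux from the two route decls through the PROVED support `FamilySectorGlue`** (its first hypothesis
discharged by the landed `Theorems.familySectorGlue_proof`): `DeligneWeilFamily → WeilVariationalHodge →
WeilTwelvefoldsSqrtMinus7`, the form in which the deciding theorem's hypothesis `h12` is fed once the two items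
close. [cite: Deligne1982HodgeCycles, proof of Thm. 4.8] [cite: Grothendieck1966, footnote 13] -/
theorem weilTwelvefoldsSqrtMinus7_of_routeItems :
    Summit.HodgeConjecture.HodgeConjecture.Theses.HeckePrymWeil.DeligneWeilFamily →
      Summit.HodgeConjecture.HodgeConjecture.Theses.HeckePrymWeil.WeilVariationalHodge →
        Summit.HodgeConjecture.HodgeConjecture.Theses.HeckePrymWeil.WeilTwelvefoldsSqrtMinus7 :=
  weilTwelvefoldsSqrtMinus7_of_familySectorGlue Theorems.familySectorGlue_proof

/-- **What remains of the crux, exactly** (UNCONDITIONAL): `WeilTwelvefoldsSqrtMinus7` is EQUIVALENT to its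
restriction to the `√-7`-abelian twelvefolds `(A, φ)` that admit NO isogeny pair `f : A → A₁ × A₁`,
`g : A₁ × A₁ → A` (`f ≫ g = [m]`, `m ≥ 1`, `f` flat, `g` intertwining the companion `(x, y) ↦ (-7·y, x)` with
`φ`) towards a tensor point — because ON the isogeny class of the tensor locus the crux is already a theorem of
the tree (`weilTwelvefoldsSqrtMinus7_on_tensorLocus`: Deligne's point-class anchor, Lemma 4.5 / Remark 4.10,
carried across the isogeny).  The residual is what the Weil transport `WT(7, 6)` (⟸ `WeilVariationalHodge`)
delivers along Deligne's family from its tensor fibre. [cite: Deligne1982HodgeCycles, Lemma 4.5 and Remark 4.10]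
[cite: vanGeemen1994HodgeAV, 5.4–5.7] -/
theorem weilTwelvefoldsSqrtMinus7_iff_offTensorLocus :
    Summit.HodgeConjecture.HodgeConjecture.Theses.HeckePrymWeil.WeilTwelvefoldsSqrtMinus7 ↔
      ∀ (A : AbelianVariety ℂ) (φ : A ⟶ A), A.dim = 12 → φ ≫ φ = -((7 : ℤ) • 𝟙 A) →
        (¬ ∃ (A₁ : AbelianVariety ℂ) (f : A ⟶ A₁.prod A₁) (g : A₁.prod A₁ ⟶ A) (m : ℕ),
            A₁.dim = 6 ∧ 0 < m ∧ f ≫ g = m • 𝟙 A ∧ AlgebraicGeometry.Flat f.hom.hom.hom.left ∧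
            g ≫ φ = AbelianVariety.prodLift (AbelianVariety.snd A₁ A₁ ≫ (-((7 : ℤ) • 𝟙 A₁)))
              (AbelianVariety.fst A₁ A₁) ≫ g) →
        ∀ c : complexBetti A.X 12, IsRationalClass c → IsOfHodgeType 12 A.X 12 6 6 c →
          c ∈ Module.End.eigenspace (complexBetti.map (𝟙 A + φ).hom.hom.hom 12).hom
                ((1 + Complex.I * (Real.sqrt (7 : ℝ) : ℂ)) ^ 12) ⊔
              Module.End.eigenspace (complexBetti.map (𝟙 A + φ).hom.hom.hom 12).hom
                ((1 - Complex.I * (Real.sqrt (7 : ℝ) : ℂ)) ^ 12) →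
          c ∈ algebraicClasses A.X 6 := by
  constructor
  · intro h A φ hA hφ _ c hrat hH hW
    exact h A φ hA hφ c hrat hH hW
  · intro h A φ hA hφ c hrat hH hW
    by_cases hT : ∃ (A₁ : AbelianVariety ℂ) (f : A ⟶ A₁.prod A₁) (g : A₁.prod A₁ ⟶ A) (m : ℕ),
        A₁.dim = 6 ∧ 0 < m ∧ f ≫ g = m • 𝟙 A ∧ AlgebraicGeometry.Flat f.hom.hom.hom.left ∧
        g ≫ φ = AbelianVariety.prodLift (AbelianVariety.snd A₁ A₁ ≫ (-((7 : ℤ) • 𝟙 A₁)))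
          (AbelianVariety.fst A₁ A₁) ≫ g
    · exact weilTwelvefoldsSqrtMinus7_restricted_to_tensorLocus A φ hA hφ hT c hrat hH hW
    · exact h A φ hA hφ hT c hrat hH hW

end Summit.HodgeConjecture.HodgeConjecture.Theorems.HeckePrymWeilLine

end
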